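import Literature.IUT.HodgeTheaters.TemperedCoveringsProp24Sub
import HarnessLib

/-!
# [IUTchI] Cor. 2.3 AT THE LEVELS of the Prop. 2.4 tower: SUB-DAG statements (B0–B4-L5) for the one open input of [IUTchII] Cor. 2.4 (i)

Mochizuki, *Inter-universal Teichmüller theory I: construction of Hodge theaters*, kurims manuscript (May
2020), §2: Cor. 2.3 (i), (vi) pp. 47–48 (proof pp. 48–49), the discussion "one may think of `Π^tp_ℍ` … as
the decomposition subgroup … associated to the sub-semi-graph `ℍ`" p. 45 l. 4–8, and the levels "`J ⊆ Δ^tp_X`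
a finite index characteristic open subgroup … `𝔾_J`" of the proof of Prop. 2.4 (i), p. 50 l. 27–42
([IUTchI] Cor 2.3 pp.47-49) [claim: Mochizuki2012, status: disputed]; consumed by *Inter-universal
Teichmüller theory II*, kurims manuscript (Dec. 2020), §2, Cor. 2.4 (i), proof p. 70 l. −2 – p. 71 l. 3: "Now,
by applying the equivalence of [IUTchI], Corollary 2.3, (vi) [cf. also [CombGC], Proposition 1.2, (ii)], to
the various finite index open subgroups of `Δ^±_v`, it follows that `γ′ ∈ Δ̂^±_{v□}` — where we use the
notation "∧" to denote the closure in `Δ̂^±_v`" ([IUTchII] Cor 2.4(i) pp.70-71) [claim: Mochizuki2012,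
status: disputed].  (D-0012 claim key; series status DISPUTED — nothing of the series is asserted here: every
declaration is pure DATA, a `Prop`-valued PREDICATE on that data, or a theorem ABOUT the predicates.)

SUB-DAG TYPING (D-0068 (1); plan/L5/SUBDAG-IUTchI-Cor23Levels.md rows B0–B4; abc-iut-L5-lead RULINGS #5/#9;
seat abc-iut-L5-t11).  ONE carrier serves Prop. 2.4 and this: the levels are abc-iut-w5-d119's
`StableCurveTemperedData.Prop24Tower` (`TemperedCoveringsProp24Sub.lean`, p414324 — NOT re-typed); here it is
EXTENDED (B0, `Prop24Tower.SubgraphLevelData`) by the level-`i` combinatorial data the printed sentence uses: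
the vertices of the dual semi-graph `𝔾_{J_i}` of the special fibre of the covering `X_{J_i} → X_k̄` with the
action of `Π^tp_X` (through `Π^tp_X/J_i`), the connected components of the inverse image `p_i⁻¹(ℍ)` of the
`G_k`-stable sub-semi-graph `ℍ ⊆ 𝔾` (as vertex sets), the distinguished component `ℍ̃_i` (the one whose
stabiliser is the decomposition group `Δ^tp_{X,ℍ}·J_i`, p. 45), and for each cusp `x` of `X` (with its
representative inertia group `I_x ⊆ Δ^tp_X`, i.e. a chosen pro-cusp `x̃`) the vertex of `𝔾_{J_i}` met by the
level-`i` cusp under `x̃`.  Pure data (TODO-merge: the specialisation datum per finite étale cover, abc-iut-L3;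
the combinatorial core is L3 graph theory — abc-iut-L3-lead's queue).  Over it, NAMED sub-statements:
* B1 (dictionary, p. 45 + p. 50): `LevelActsTrivially`, `DeltaHStabilizes`, `StabLeDeltaHLevel`
  ("`Stab_{Δ^tp_X}(ℍ̃_i) = Δ^tp_{X,ℍ}·J_i`"; the iff is PROVED from the three: `stabilizes_iff`);
* B2 (Cor. 2.3 (i) at level `i` under the dictionary `Δ^tp_{X_{J_i},ℍ̃_i} = Δ^tp_{X,ℍ} ∩ J_i`): `LevelCommTerminal`;
* B3 (Cor. 2.3 (vi), (a) ⇒ (b), at level `i`): `LevelIncidence`;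
* B4 core ([CombGC] Prop 1.2 (ii)-type component combinatorics): `CompsDisjoint`, `CompsInvariant`
  (⇒ `IsBlock`, PROVED: `isBlock_of_comps`);
* B4-L5 (the finite-level shadow of "`γ′ ∈ Δ̂^±_{v□}`"): `LevelTarget`, PROVED from base-level Cor. 2.3 (i)
  (abc-iut-L5-t1's `Cor23i`, via `piXH_inf_delta_of_cor23i`) + B3 + `IsBlock` + B1 (`levelTarget_of_inputs`), and
  pushed into `Π̂_X` in EXACTLY the binder shapes of the L6 consumer (abc-iut-w5-d121's
  `StableCurveAgreement.h23vi_of_piHatLevelData`: `incD`/`blkD`/`stabD`, levels `U'_i := Ĵ_i`):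
  `incD_of_levelIncidence`, `blkD_of_isBlock`, `stabD_of_stabLeDeltaHLevel`, `levelTarget_hat`, and the levels'
  shrinking `Prop24Tower.exists_level_subset_of_mem_nhds` (`hbasis'`).
The TRANSLATION to [IUTchII]'s `Π^±_v`-objects and the assembly B5 are L6's (no upward import here).  No new
Literature FACT; no instance, no notation; nothing here bears on [IUTchIII] Cor. 3.12; typed ≠ discharged.
-/

namespace Literature.IUT.HodgeTheaters

open Pointwise
open _root_.Topology
open Literature.AnabelianGeometry.AbsoluteAnabelian (IsCommensurablyTerminal)

universe u

namespace StableCurveTemperedData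

variable {D : StableCurveTemperedData.{u}}

/-! ### Two pieces of `ι`-plumbing -/

/-- A tempered geometric element of `Π̂_X` — `g' ∈ ι(Π^tp_X) ∩ Δ̂_X` — is `ι(γ)` for a `γ ∈ Δ^tp_X`.
[cite: Mochizuki2012, §2 p.47] -/
theorem exists_deltaTp_of_mem_range_of_mem_deltaHat {g' : D.PiHat} (hg : g' ∈ D.ιX.range)
    (hΔ : g' ∈ D.DeltaHat) : ∃ γ : D.DeltaTp, D.ιX (γ : D.PiTp) = g' := by
  obtain ⟨γ₀, rfl⟩ := hg
  have hγ₀ : γ₀ ∈ D.DeltaTp := by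
    rw [MonoidHom.mem_ker, ← D.prHat_ιX]
    exact hΔ
  exact ⟨⟨γ₀, hγ₀⟩, rfl⟩

/-- Conjugating by `ι(t)` inside `Π̂_X` the image of a subgroup of `Π^tp_X` is the image of the conjugate.
[cite: Mochizuki2012, §2 p.47] -/
theorem conj_smul_map_ιX (t : D.PiTp) (K : Subgroup D.PiTp) :
    MulAut.conj (D.ιX t) • K.map D.ιX = (MulAut.conj t • K).map D.ιX := by
  ext y
  constructor
  · rintro ⟨_, ⟨k, hk, rfl⟩, rfl⟩
    refine ⟨t * k * t⁻¹, ⟨k, hk, rfl⟩, ?_⟩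
    change D.ιX (t * k * t⁻¹) = MulAut.conj (D.ιX t) • D.ιX k
    rw [MulAut.smul_def, MulAut.conj_apply, map_mul, map_mul, map_inv]
  · rintro ⟨_, ⟨k, hk, rfl⟩, rfl⟩
    refine ⟨D.ιX k, ⟨k, hk, rfl⟩, ?_⟩
    change MulAut.conj (D.ιX t) • D.ιX k = D.ιX (MulAut.conj t • k)
    rw [MulAut.smul_def, MulAut.conj_apply, MulAut.smul_def, MulAut.conj_apply, map_mul, map_mul, map_inv]

namespace Prop24Tower

variable (T : D.Prop24Tower)

/-! ### B0 — the levels carrier extension (data) -/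

/-- **B0 LEVEL SUBGRAPH DATA** over the Prop. 2.4 tower (one carrier for both sub-DAGs): for each level
`i` ("`J ⊆ Δ^tp_X` a finite index characteristic open subgroup", `𝔾_J` "the pro-`Σ` semi-graph of anabelioids
associated to the special fiber of the stable model … of the finite étale covering of `X ×_k k̄` determined by
`J`", [IUTchI] p. 50 l. 27–30) — the vertices of `𝔾_{J_i}`, the action of `Π^tp_X` on them (through
`Π^tp_X/J_i`; `J_i` is characteristic in `Δ^tp_X`, hence normal in `Π^tp_X`), the connected components of the
inverse image of the `G_k`-stable connected sub-semi-graph `ℍ ⊆ 𝔾` (p. 47) in `𝔾_{J_i}` as vertex sets, the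
component `ℍ̃_i` singled out by the decomposition subgroup `Π^tp_ℍ` ("one may think of `Π^tp_ℍ` … as the
decomposition subgroup in `Π^tp_𝔾` … associated to the sub-semi-graph `ℍ`", p. 45 l. 4–8), and, for each cusp
`x` of `X` (whose representative inertia group `I_x ⊆ Δ^tp_X` fixes a pro-cusp `x̃` over `x`), the vertex of
`𝔾_{J_i}` to which the cusp of `X_{J_i}` under `x̃` abuts.  Pure data; nothing about it is asserted (the printed
properties are the predicates below). [cite: Mochizuki2012, Prop 2.4(i) p.50] -/
structure SubgraphLevelData : Type (u + 1) where
  /-- the vertices of `𝔾_{J_i}` (irreducible components of the special fibre of the stable model of `X_{J_i}`) -/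
  Vtx : T.I → Type u
  /-- the action of `Π^tp_X` on the vertices of `𝔾_{J_i}` -/
  act : ∀ i, D.PiTp →* Equiv.Perm (Vtx i)
  /-- the connected components of `p_i⁻¹(ℍ) ⊆ 𝔾_{J_i}`, as sets of vertices -/
  comps : ∀ i, Set (Set (Vtx i))
  /-- `ℍ̃_i`, the component of `p_i⁻¹(ℍ)` whose stabiliser is the decomposition group `Δ^tp_{X,ℍ}·J_i` -/
  compH : ∀ i, Set (Vtx i)
  /-- `ℍ̃_i` is one of the components -/
  compH_mem : ∀ i, compH i ∈ comps i
  /-- the vertex of `𝔾_{J_i}` met by the level-`i` cusp lying under the pro-cusp `x̃` of the cusp `x` -/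
  vtxCusp : ∀ i, D.Cusp → Vtx i

namespace SubgraphLevelData

variable {T} (L : T.SubgraphLevelData)

/-! ### B4 core — component combinatorics ([CombGC] Prop. 1.2 (ii)-type; L3 graph theory) -/

/-- **B4 core (i): distinct connected components of `p_i⁻¹(ℍ)` are DISJOINT** ([IUTchII] p. 71 l. 1 "[cf. also
[CombGC], Proposition 1.2, (ii)]"; elementary semi-graph combinatorics, to be PROVED by the L3 owner of the
coverings of semi-graphs once the carrier is instantiated).  A predicate, not asserted.
[cite: Mochizuki2012, Cor 2.3(vi) p.48] -/
def CompsDisjoint : Prop :=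
  ∀ i, ∀ A ∈ L.comps i, ∀ B ∈ L.comps i, (A ∩ B).Nonempty → A = B

/-- **B4 core (ii): `Π^tp_X` PERMUTES the connected components of `p_i⁻¹(ℍ)`** (`ℍ` is stabilised by the natural
action of `G_k` on `𝔾`, [IUTchI] p. 47, and `p_i : 𝔾_{J_i} → 𝔾` is equivariant).  A predicate, not asserted.
[cite: Mochizuki2012, Cor 2.3 p.47] -/
def CompsInvariant : Prop :=
  ∀ i (t : D.PiTp), ∀ A ∈ L.comps i, (L.act i t) '' A ∈ L.comps i

/-- **B4 core, in the consumer's shape (`blkD`): `ℍ̃_i` is a BLOCK of the `Π^tp_X`-action** — an element moving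
one vertex of `ℍ̃_i` into `ℍ̃_i` maps all of `ℍ̃_i` into `ℍ̃_i`.  A predicate (PROVED from `CompsDisjoint` +
`CompsInvariant` in `isBlock_of_comps`). [cite: Mochizuki2012, Cor 2.3(vi) p.48] -/
def IsBlock : Prop :=
  ∀ i (t : D.PiTp), (∃ v ∈ L.compH i, L.act i t v ∈ L.compH i) → ∀ v ∈ L.compH i, L.act i t v ∈ L.compH i

/-- `IsBlock` from the component combinatorics: a component meeting its own translate equals it.
[cite: Mochizuki2012, Cor 2.3(vi) p.48] -/
theorem isBlock_of_comps (hdisj : L.CompsDisjoint) (hinv : L.CompsInvariant) : L.IsBlock := by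
  intro i t hmeet v hv
  obtain ⟨w, hw, htw⟩ := hmeet
  have hA : (L.act i t) '' L.compH i ∈ L.comps i := hinv i t _ (L.compH_mem i)
  have heq : (L.act i t) '' L.compH i = L.compH i :=
    hdisj i _ hA _ (L.compH_mem i) ⟨L.act i t w, ⟨w, hw, rfl⟩, htw⟩
  rw [← heq]
  exact ⟨v, hv, rfl⟩

/-! ### B1 — the dictionary "`Stab_{Δ^tp_X}(ℍ̃_i) = Δ^tp_{X,ℍ} · J_i`" (p. 45 l. 4–8 with p. 50 l. 27–30) -/

/-- **B1 (a): `J_i` acts trivially on `𝔾_{J_i}`** (the action of `Π^tp_X` on the special fibre of `X_{J_i}` factors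
through `Π^tp_X/J_i`).  A predicate, not asserted. [cite: Mochizuki2012, Prop 2.4(i) p.50] -/
def LevelActsTrivially : Prop :=
  ∀ i, ∀ j ∈ D.levelTp (T.Jhat i), L.act i (j : D.PiTp) = 1

/-- **B1 (b): the decomposition group `Δ^tp_{X,ℍ}` stabilises `ℍ̃_i`** ("`Π^tp_ℍ` … the decomposition subgroup …
associated to the sub-semi-graph `ℍ`", p. 45 l. 4–8; `Δ^tp_{X,ℍ} := Δ^tp_X ×_{Π^tp_𝔾} Π^tp_ℍ`, Cor. 2.3 (i) p. 47).
A predicate, not asserted. [cite: Mochizuki2012, Cor 2.3(i) p.47] -/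
def DeltaHStabilizes : Prop :=
  ∀ i, ∀ k ∈ D.deltaTpH, ∀ v ∈ L.compH i, L.act i (k : D.PiTp) v ∈ L.compH i

/-- **B1 (c), the content direction (the consumer's `stabD`): `Stab_{Δ^tp_X}(ℍ̃_i) ⊆ Δ^tp_{X,ℍ} · J_i`** — an
element of `Δ^tp_X` mapping `ℍ̃_i` into itself lies in `Δ^tp_{X,ℍ}` up to `J_i` (the components of the inverse
image of `ℍ̃_i` in the universal tempered covering are permuted transitively by `J_i`, and `Δ^tp_{X,ℍ}` is the
stabiliser of one of them, p. 45 l. 4–8).  A predicate, not asserted. [cite: Mochizuki2012, Prop 2.2 p.45] -/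
def StabLeDeltaHLevel : Prop :=
  ∀ i (γ : D.DeltaTp), (∀ v ∈ L.compH i, L.act i (γ : D.PiTp) v ∈ L.compH i) →
    ∃ k ∈ D.deltaTpH, k⁻¹ * γ ∈ D.levelTp (T.Jhat i)

/-- **B1, the dictionary as an equivalence** — PROVED from (a), (b), (c): for `γ ∈ Δ^tp_X`, `γ` stabilises `ℍ̃_i`
iff `γ ∈ Δ^tp_{X,ℍ} · J_i`. [cite: Mochizuki2012, Prop 2.2 p.45] -/
theorem stabilizes_iff (htriv : L.LevelActsTrivially) (hH : L.DeltaHStabilizes) (hstab : L.StabLeDeltaHLevel)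
    (i : T.I) (γ : D.DeltaTp) :
    (∀ v ∈ L.compH i, L.act i (γ : D.PiTp) v ∈ L.compH i) ↔
      ∃ k ∈ D.deltaTpH, k⁻¹ * γ ∈ D.levelTp (T.Jhat i) := by
  refine ⟨hstab i γ, ?_⟩
  rintro ⟨k, hk, hj⟩ v hv
  have hγ : (γ : D.PiTp) = (k : D.PiTp) * ((k⁻¹ * γ : D.DeltaTp) : D.PiTp) := by
    simp only [Subgroup.coe_mul, Subgroup.coe_inv, mul_inv_cancel_left]
  rw [hγ, map_mul, htriv i _ hj, mul_one]
  exact hH i k hk v hv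

/-! ### B2 — Cor. 2.3 (i) at level `i` -/

/-- **B2: Cor. 2.3 (i) for `X_{J_i}` and `ℍ̃_i`** under the dictionary `Δ^tp_{X_{J_i},ℍ̃_i} = Δ^tp_{X,ℍ} ∩ J_i`:
"`Δ^tp_{X_{J_i},ℍ̃_i} ⊆ Δ^tp_{X_{J_i}} = J_i` is commensurably terminal" (p. 47).  [Recorded per the sub-DAG row B2;
the B4-L5 derivation below uses only the BASE-level Cor. 2.3 (i) (`Cor23i`).]  A predicate, not asserted.
[cite: Mochizuki2012, Cor 2.3(i) p.47] -/
def LevelCommTerminal : Prop :=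
  ∀ i, IsCommensurablyTerminal ((D.deltaTpH ⊓ D.levelTp (T.Jhat i)).subgroupOf (D.levelTp (T.Jhat i)))

/-! ### B3 — Cor. 2.3 (vi), (a) ⇒ (b), at level `i` -/

/-- **B3: Cor. 2.3 (vi), (a) ⇒ (b), for `X_{J_i}`, `ℍ̃_i` and the cusp of `X_{J_i}` under the pro-cusp `t·x̃`**
(`t ∈ Π^tp_X`; its inertia group in `Δ^tp_X` is `I_{t·x̃} = t I_x t⁻¹`, its inertia group in `J_i` is
`I_{t·x̃} ∩ J_i`, the vertex it abuts to is `t · (vertex of x̃)`): "`I_x` lies in a `Δ^tp_X`-conjugate of `Δ^tp_{X,ℍ}`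
[⇒] `ξ` meets an irreducible component of the special fiber of `𝔛` that is contained in `ℍ`" (p. 48) read at
level `i` — if `I_{t·x̃} ∩ J_i` lies in a `J_i`-conjugate of `Δ^tp_{X,ℍ} ∩ J_i = Δ^tp_{X_{J_i},ℍ̃_i}` (dictionary B1),
then the vertex `t · (vertex of x̃)` of `𝔾_{J_i}` lies in `ℍ̃_i`.  By-name supplier at the merge: abc-iut-L5-t1's
`Cor23vi` (`TemperedCoverings.lean`) for the level-`i` datum.  A predicate, not asserted.
[cite: Mochizuki2012, Cor 2.3(vi) p.48] -/
def LevelIncidence : Prop :=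
  ∀ i (x : D.Cusp) (t : D.PiTp),
    (∃ j ∈ (D.levelTp (T.Jhat i)).map D.DeltaTp.subtype,
      MulAut.conj t • ((D.inertiaTp x).map D.DeltaTp.subtype) ⊓ (D.levelTp (T.Jhat i)).map D.DeltaTp.subtype ≤
        MulAut.conj j • ((D.deltaTpH ⊓ D.levelTp (T.Jhat i)).map D.DeltaTp.subtype)) →
    L.act i t (L.vtxCusp i x) ∈ L.compH i

end SubgraphLevelData

/-! ### B4-L5 — the per-level target and its derivation -/

/-- **B4-L5, the finite-level shadow of "`γ′ ∈ Δ̂^±_{v□}`"** ([IUTchII] p. 71 l. 1–3, in [IUTchI]'s terms): for a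
cusp `t·x̃` MEETING `ℍ` (its inertia group `t I_x t⁻¹` lies in `Δ^tp_{X,ℍ}` — "`t ∈ LabCusp^±(□)`", [IUTchII] p. 70)
and `γ ∈ Δ^tp_X` with `γ (t I_x t⁻¹) γ⁻¹ ⊆ Π^tp_{X,ℍ}` (hypothesis (c) of [IUTchII] Cor. 2.4 (i)), `γ` lies in
`Δ^tp_{X,ℍ} · J_i`.  A predicate (PROVED from the named inputs in `levelTarget_of_inputs`).
[cite: Mochizuki2012, Cor 2.3(vi) p.48] -/
def LevelTarget : Prop :=
  ∀ i (x : D.Cusp) (t : D.PiTp),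
    MulAut.conj t • ((D.inertiaTp x).map D.DeltaTp.subtype) ≤ D.deltaTpH.map D.DeltaTp.subtype →
    ∀ γ : D.DeltaTp,
      MulAut.conj ((γ : D.PiTp) * t) • ((D.inertiaTp x).map D.DeltaTp.subtype) ≤ D.piTpXH →
      ∃ k ∈ D.deltaTpH, k⁻¹ * γ ∈ D.levelTp (T.Jhat i)

/-- An inertia group inside `Δ^tp_{X,ℍ}`, intersected with `J_i`, lies in (the trivial `J_i`-conjugate of)
`Δ^tp_{X,ℍ} ∩ J_i` — the hypothesis of `LevelIncidence` with `j = 1`. [cite: Mochizuki2012, Cor 2.3(vi) p.48] -/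
theorem levelIncidence_hyp_of_le (i : T.I) {I : Subgroup D.PiTp}
    (hI : I ≤ D.deltaTpH.map D.DeltaTp.subtype) :
    ∃ j ∈ (D.levelTp (T.Jhat i)).map D.DeltaTp.subtype,
      I ⊓ (D.levelTp (T.Jhat i)).map D.DeltaTp.subtype ≤
        MulAut.conj j • ((D.deltaTpH ⊓ D.levelTp (T.Jhat i)).map D.DeltaTp.subtype) := by
  refine ⟨1, one_mem _, ?_⟩
  rw [map_one, one_smul]
  rintro y ⟨hyI, ⟨d, hd, rfl⟩⟩
  obtain ⟨d', hd', hdd'⟩ := hI hyI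
  have : d' = d := Subtype.ext hdd'
  subst this
  exact ⟨d', ⟨hd', hd⟩, rfl⟩

namespace SubgraphLevelData

variable {T} (L : T.SubgraphLevelData)

/-- **B4-L5 DERIVED** (the printed one-sentence argument, [IUTchII] p. 70 l. −2 – p. 71 l. 3, at one level):
from BASE-level Cor. 2.3 (i) (`Cor23i`: `Π^tp_{X,ℍ} ∩ Δ^tp_X = Δ^tp_{X,ℍ}`, so the conjugated inertia group lies in
`Δ^tp_{X,ℍ}`), B3 `LevelIncidence` (twice: for the cusps `t·x̃` and `γt·x̃`, so both `t·c` and `γ·(t·c)` lie in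
`ℍ̃_i`, `c` the vertex of `x̃`), the block property `IsBlock` (so `γ` stabilises `ℍ̃_i`), and the dictionary
`StabLeDeltaHLevel`. [cite: Mochizuki2012, Cor 2.3(vi) p.48] -/
theorem levelTarget_of_inputs (h23i : D.Cor23i) (hinc : L.LevelIncidence) (hblk : L.IsBlock)
    (hstab : L.StabLeDeltaHLevel) : T.LevelTarget := by
  intro i x t hmeet γ hγ
  -- the conjugated inertia group `γ t I_x t⁻¹ γ⁻¹` lies in `Π^tp_{X,ℍ} ∩ Δ^tp_X = Δ^tp_{X,ℍ}`
  have hΔ : MulAut.conj ((γ : D.PiTp) * t) • ((D.inertiaTp x).map D.DeltaTp.subtype) ≤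
      D.deltaTpH.map D.DeltaTp.subtype := by
    rw [← (D.piXH_inf_delta_of_cor23i h23i).1]
    refine le_inf hγ ?_
    rintro _ ⟨y, ⟨d, _, rfl⟩, rfl⟩
    change ((γ : D.PiTp) * t) * (d : D.PiTp) * ((γ : D.PiTp) * t)⁻¹ ∈ D.DeltaTp
    exact (MonoidHom.normal_ker D.prTp).conj_mem _ d.2 _
  -- B3 for the cusp `γt·x̃`: its vertex `γ·(t·c)` lies in `ℍ̃_i`
  have h1 : L.act i ((γ : D.PiTp) * t) (L.vtxCusp i x) ∈ L.compH i :=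
    hinc i x _ (T.levelIncidence_hyp_of_le i hΔ)
  -- B3 for the cusp `t·x̃`: its vertex `t·c` lies in `ℍ̃_i`
  have h0 : L.act i t (L.vtxCusp i x) ∈ L.compH i := hinc i x t (T.levelIncidence_hyp_of_le i hmeet)
  rw [map_mul, Equiv.Perm.mul_apply] at h1
  -- `γ` moves a vertex of `ℍ̃_i` into `ℍ̃_i`, hence stabilises the block `ℍ̃_i`
  exact hstab i γ (hblk i (γ : D.PiTp) ⟨_, h0, h1⟩)

/-! ### The consumer's shapes on the `Π̂_X` side (levels `U'_i := Ĵ_i`; tempered geometric `g' = ι(γ)`) -/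

/-- **`incD` of the consumer** (abc-iut-w5-d121's `StableCurveAgreement.h23vi_of_piHatLevelData`), from B3
`LevelIncidence` and base Cor. 2.3 (i): for the cusp `t·x̃` meeting `ℍ` and tempered geometric `g'`, if
`(ι(t I_x t⁻¹))^{g'} ⊆ ι(Π^tp_{X,ℍ})` then `g'` moves the vertex `t·c` into `ℍ̃_i` (the `Π̂_X`-action on vertices
being `act ∘ ι⁻¹` on tempered elements: stated for `g' = ι(γ)`). [cite: Mochizuki2012, Cor 2.3(vi) p.48] -/
theorem incD_of_levelIncidence (h23i : D.Cor23i) (hinc : L.LevelIncidence) (i : T.I) (x : D.Cusp) (t : D.PiTp)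
    (γ : D.DeltaTp)
    (hc : MulAut.conj (D.ιX (γ : D.PiTp)) •
        (MulAut.conj t • ((D.inertiaTp x).map D.DeltaTp.subtype)).map D.ιX ≤ D.piTpXH.map D.ιX) :
    L.act i (γ : D.PiTp) (L.act i t (L.vtxCusp i x)) ∈ L.compH i := by
  rw [conj_smul_map_ιX, Subgroup.map_le_map_iff_of_injective D.ιX_injective, smul_smul, ← map_mul] at hc
  have hΔ : MulAut.conj ((γ : D.PiTp) * t) • ((D.inertiaTp x).map D.DeltaTp.subtype) ≤
      D.deltaTpH.map D.DeltaTp.subtype := by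
    rw [← (D.piXH_inf_delta_of_cor23i h23i).1]
    refine le_inf hc ?_
    rintro _ ⟨y, ⟨d, _, rfl⟩, rfl⟩
    change ((γ : D.PiTp) * t) * (d : D.PiTp) * ((γ : D.PiTp) * t)⁻¹ ∈ D.DeltaTp
    exact (MonoidHom.normal_ker D.prTp).conj_mem _ d.2 _
  have h1 := hinc i x _ (T.levelIncidence_hyp_of_le i hΔ)
  rwa [map_mul, Equiv.Perm.mul_apply] at h1

/-- **`blkD` of the consumer** is `IsBlock` read at `g' = ι(γ)`. [cite: Mochizuki2012, Cor 2.3(vi) p.48] -/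
theorem blkD_of_isBlock (hblk : L.IsBlock) (i : T.I) (γ : D.DeltaTp)
    (h : ∃ v ∈ L.compH i, L.act i (γ : D.PiTp) v ∈ L.compH i) :
    ∀ v ∈ L.compH i, L.act i (γ : D.PiTp) v ∈ L.compH i :=
  hblk i (γ : D.PiTp) h

/-- **`stabD` of the consumer** (levels `U'_i := Ĵ_i ⊆ Π̂_X`), from B1 (c) `StabLeDeltaHLevel`: if `γ ∈ Δ^tp_X`
stabilises `ℍ̃_i` then `ι(γ) ∈ ι(Δ^tp_{X,ℍ}) · Ĵ_i`. [cite: Mochizuki2012, Prop 2.2 p.45] -/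
theorem stabD_of_stabLeDeltaHLevel (hstab : L.StabLeDeltaHLevel) (i : T.I) (γ : D.DeltaTp)
    (h : ∀ v ∈ L.compH i, L.act i (γ : D.PiTp) v ∈ L.compH i) :
    ∃ k' ∈ (D.deltaTpH.map D.ιΔ).map D.DeltaHat.subtype, k'⁻¹ * D.ιX (γ : D.PiTp) ∈ T.Jhat i := by
  obtain ⟨k, hk, hj⟩ := hstab i γ h
  refine ⟨D.ιX (k : D.PiTp), ⟨D.ιΔ k, ⟨k, hk, rfl⟩, rfl⟩, ?_⟩
  rw [← map_inv, ← map_mul]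
  exact (D.mem_levelTp).mp hj

end SubgraphLevelData

/-- **B4-L5 on the `Π̂_X` side, in the consumer's shape** (`hlevel`-type statement with `U'_i := Ĵ_i`): for the cusp
`t·x̃` meeting `ℍ` and tempered geometric `g'` (`= ι(γ)`, `γ ∈ Δ^tp_X`) with `(ι(t I_x t⁻¹))^{g'} ⊆ ι(Π^tp_{X,ℍ})`,
there is `k' ∈ ι(Δ^tp_{X,ℍ})` with `k'⁻¹ g' ∈ Ĵ_i`.  From `LevelTarget`. [cite: Mochizuki2012, Cor 2.3(vi) p.48] -/
theorem levelTarget_hat (hT : T.LevelTarget) (i : T.I) (x : D.Cusp) (t : D.PiTp)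
    (hmeet : MulAut.conj t • ((D.inertiaTp x).map D.DeltaTp.subtype) ≤ D.deltaTpH.map D.DeltaTp.subtype)
    {g' : D.PiHat} (hg : g' ∈ D.ιX.range) (hgΔ : g' ∈ D.DeltaHat)
    (hc : MulAut.conj g' • (MulAut.conj t • ((D.inertiaTp x).map D.DeltaTp.subtype)).map D.ιX ≤
      D.piTpXH.map D.ιX) :
    ∃ k' ∈ (D.deltaTpH.map D.ιΔ).map D.DeltaHat.subtype, k'⁻¹ * g' ∈ T.Jhat i := by
  obtain ⟨γ, rfl⟩ := exists_deltaTp_of_mem_range_of_mem_deltaHat hg hgΔ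
  rw [conj_smul_map_ιX, Subgroup.map_le_map_iff_of_injective D.ιX_injective, smul_smul, ← map_mul] at hc
  obtain ⟨k, hk, hj⟩ := hT i x t hmeet γ hc
  refine ⟨D.ιX (k : D.PiTp), ⟨D.ιΔ k, ⟨k, hk, rfl⟩, rfl⟩, ?_⟩
  rw [← map_inv, ← map_mul]
  exact (D.mem_levelTp).mp hj

/-! ### The levels shrink to `1` in `Π̂_X` (the consumer's `hbasis'`) -/

/-- **"the various finite index open subgroups of `Δ^±_v`" shrink to `1`** ([IUTchII] p. 71 l. 1; [IUTchI] p. 50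
l. 40 "by allowing `J` to vary"): with `Π̂_X` profinite and `Δ̂_X` closed, cofinal levels inside `Δ̂_X` are
eventually inside every neighbourhood of `1` in `Π̂_X`.  PROVED. [cite: Mochizuki2012, Prop 2.4(i) p.50] -/
theorem exists_level_subset_of_mem_nhds [T2Space D.PiHat] [TotallyDisconnectedSpace D.PiHat]
    (hΔc : D.DeltaHatClosed) (hΔ : T.LevelsInDelta) (hcof : T.LevelsCofinal) :
    ∀ O ∈ 𝓝 (1 : D.PiHat), ∃ i, ((T.Jhat i : Subgroup D.PiHat) : Set D.PiHat) ⊆ O := by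
  intro O hO
  haveI : CompactSpace D.DeltaHat := isCompact_iff_compactSpace.mp hΔc.isCompact
  have hO' : ((↑) : D.DeltaHat → D.PiHat) ⁻¹' O ∈ 𝓝 (1 : D.DeltaHat) :=
    continuous_subtype_val.continuousAt hO
  obtain ⟨V, hVO, hVopen, hV1⟩ := mem_nhds_iff.mp hO'
  obtain ⟨U, hU⟩ := ProfiniteGrp.exist_openNormalSubgroup_sub_open_nhds_of_one hVopen hV1
  obtain ⟨i, hi⟩ := hcof U.toSubgroup U.isOpen'
  refine ⟨i, fun y hy => ?_⟩
  have h1 : (⟨y, hΔ i hy⟩ : D.DeltaHat) ∈ U := hi (show (⟨y, hΔ i hy⟩ : D.DeltaHat) ∈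
    (T.Jhat i).subgroupOf D.DeltaHat from hy)
  exact hVO (hU h1)

end Prop24Tower

end StableCurveTemperedData

end Literature.IUT.HodgeTheaters
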